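import Summits.CriticalPhenomena.PercolationContinuityZ3.Theorems.Transplant.KNLevelsStepVAffine
import Summits.CriticalPhenomena.PercolationContinuityZ3.Theorems.Transplant.KNLevelsTargetChain
import HarnessLib

/-!
# Kozma–Nitzan Lemma 10 over the levels of a graph with a LINEAR accuracy transfer: `P(o ↔ B) > 1 − δ` and kits at accuracy `δ` give
# `P(o ↔ T) > 1 − 7δ` (assembly of Step II with the affine Step V; companion of `KNLevels.targetLemma_of_kits`; P5-SHARPNESS §17.7 (iv))

builds on p205010 (kernel theorem, internal audit signed; external expert review pending): via `LHyp.stepV_in_affine` (`KNLevelsStepVAffine`), which uses the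
tree's affine `AdditiveGluing`.  Status sentence (coordinator 2026-08-20T04:30Z): "θ(p_c) = 0 on ℤ^d, all d ≥ 2 — kernel-verified (Lean 4/Mathlib,
standard axioms); internal adversarial audit SIGNED 2026-08-20 04:29Z; external expert review pending."
Lane `prim-bschramm`, seat p5 (refuter, generation 2); helper file (`--supports stmt-CriticalPhenomena-4575`).

`KNLevels.targetLemma_of_kits` has the shape `∀ ε > 0, ∃ δ, …` with `δ ≍ ε²` (Kozma–Nitzan's Step V).  With the affine Step V the dependence is explicit and
LINEAR, and no gluing hypothesis is needed:
* **`targetLemma_of_kits_affine`** — degrees `≤ Δ`, `p < 1`, `0 < δ`, `3δ ≤ 1`; level data with `LHyp`, target `∅ ≠ T ⊆ D`, a level range `[j₀, j₁]`, `j₁ ≤ R`,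
  with `(1−p)^{−ΔN} ≤ δ · #[j₀, j₁]` and a kit at every level of the range at accuracy `δ` (exactly the kit clause of `targetLemma_of_kits` / `TStep.KitsAt`);
  then `1 − δ < P_W(o ↔ B)` implies `1 − 7δ < P_W(o ↔ T)`.
* **`TStep.targetLemma_affine`** — the same read off a `TStep` with `KitsAt W p Δ δ`.
Consequence for chains: `n` linked steps cost accuracy `7^n` (plus nothing), instead of the `2^n`-fold iterated square of the ε–δ version.

[cite: KozmaNitzan2024, §4 Lemma 10 (pp. 17–22); Conjecture 1 (p. 3)] [cite: GrimmettPercolation1999, §7.2]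
-/

noncomputable section

open MeasureTheory ProbabilityTheory
open scoped ENNReal

namespace Summit.CriticalPhenomena.PercolationContinuityZ3.Theorems

namespace Transplant

namespace KNLevels

open Literature.Probability.Percolation Literature.Probability.LatticeModels SimpleGraph

variable {V : Type} [DecidableEq V] [Countable V] {G : SimpleGraph V} [G.LocallyFinite]

/-- **Lemma 10 with a linear transfer, from per-level kits.**  Degrees `≤ Δ`, `p < 1`, `0 < δ ≤ 1/3`; level data `L` with `LHyp L W p D R`, target
`∅ ≠ T ⊆ D`, a level range `[j₀, j₁]` with `j₁ ≤ R` and `(1−p)^{−ΔN} ≤ δ·#[j₀, j₁]`, and at every level of the range seed data `σ` (`SHyp`, `σ.N ≤ N`,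
`(1 − p^{sB})^k ≤ δ`), a shell `S ⊆ B⟨j⟩ ∩ D` avoided by the seeds and containing the faces, and the Step-IV estimate at accuracy `δ`.  Then
`1 − δ < P_W(o ↔ B) ⟹ 1 − 7δ < P_W(o ↔ T)`.  Proof: Step II (`LHyp.stepII`) picks a level with `≥ N` contacts with probability `> 1 − 2δ`, then
`LHyp.stepV_in_affine` with `Rg := D`. [cite: KozmaNitzan2024, §4 Lemma 10 (pp. 17–22)] -/
theorem targetLemma_of_kits_affine {Δ : ℕ} (hΔ : ∀ x, G.degree x ≤ Δ) (p : unitInterval) (hp1 : (p : ℝ) < 1)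
    {δ : ℝ} (hδ : 0 < δ) (h3δ : 3 * δ ≤ 1)
    (L : LData G) (W : Sym2 V → unitInterval) (D T : Finset V) (R N j₀ j₁ : ℕ)
    (hL : LHyp L W p D R) (hj₁ : j₁ ≤ R) (hTD : T ⊆ D) (hTne : T.Nonempty)
    (hJ : 1 / (1 - (p : ℝ)) ^ (Δ * N) ≤ δ * ((Finset.Icc j₀ j₁).card : ℝ))
    (hkits : ∀ j ∈ Finset.Icc j₀ j₁, ∃ (σ : SData V) (S : Finset V), SHyp L j σ ∧ σ.N ≤ N ∧
      (1 - (p : ℝ) ^ σ.sB) ^ σ.k ≤ δ ∧ S ⊆ L.X j ∧ S ⊆ D ∧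
      (∀ x ∈ σ.K, ∀ e ∈ σ.seed x, e ∉ wireSet (↑S : Set V)) ∧ (∀ x ∈ σ.K, σ.face x ⊆ S) ∧
      (∀ x ∈ σ.K, 1 - 3 * δ ≤ (prodBernoulli W).real {ω | ∃ u ∈ σ.face x,
        1 - δ < (prodBernoulli (pinW W (wireSet (↑S : Set V)) ω)).real (⋃ t ∈ T, openConnIn (↑D : Set V) u t)}))
    (hreach : 1 - δ < (prodBernoulli W).real L.reachB) :
    1 - 7 * δ < (prodBernoulli W).real (⋃ t ∈ T, openConn L.o t) := by
  classical
  -- Step II: a level with many contacts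
  obtain ⟨j, hjJ, hII⟩ := hL.stepII hΔ hp1 (N := N) hj₁ hJ hreach
  have hjR : j ≤ R := (Finset.mem_Icc.1 hjJ).2.trans hj₁
  -- the kit at that level
  obtain ⟨σ, S, hσ, hN, hIII, hSX, hSD, hSseed, hUS, hIV⟩ := hkits j hjJ
  -- Step II's output in the `Fail` form for `σ.N ≤ N`
  have hII' : 1 - 2 * δ < (prodBernoulli W).real (L.Fail σ.N j)ᶜ := by
    refine hII.trans_le (measureReal_mono (fun ω hω => ?_) (measure_ne_top _ _))
    rw [LData.compl_Fail_eq]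
    exact hN.trans hω
  -- Steps III–V, affine
  exact hL.stepV_in_affine (Rg := (↑D : Set V)) hσ hjR hSX hSD hSseed hTD hTne hδ h3δ hII' hIII hUS hIV

/-- **Lemma 10 with a linear transfer, read off a target step with kits** (`TStep.KitsAt W p Δ δ`): `1 − δ < P_W(o ↔ X 0) ⟹ 1 − 7δ < P_W(o ↔ T)`.
[cite: KozmaNitzan2024, §4 Lemma 10 (pp. 17–22)] -/
theorem TStep.targetLemma_affine {Δ : ℕ} (hΔ : ∀ x, G.degree x ≤ Δ) {p : unitInterval} (hp1 : (p : ℝ) < 1)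
    {δ : ℝ} (hδ : 0 < δ) (h3δ : 3 * δ ≤ 1) {W : Sym2 V → unitInterval} (s : TStep G) (hs : s.KitsAt W p Δ δ)
    (hreach : 1 - δ < (prodBernoulli W).real s.L.reachB) :
    1 - 7 * δ < (prodBernoulli W).real (⋃ t ∈ s.T, openConn s.L.o t) := by
  obtain ⟨hL, hj, hTD, hTne, hJ, hkits⟩ := hs
  exact targetLemma_of_kits_affine hΔ p hp1 hδ h3δ s.L W s.D s.T s.R s.N s.j₀ s.j₁ hL hj hTD hTne hJ hkits hreach

end KNLevels

end Transplant

end Summit.CriticalPhenomena.PercolationContinuityZ3.Theorems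

end
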